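import Summits.QuantumFields.YangMills.Theorems.AlphaInputsT3ACv3StartAssembly
import Summits.QuantumFields.YangMills.Theorems.AlphaInputsT3ACv3BallGraft
import Summits.QuantumFields.YangMills.Theorems.AlphaInputsT3ACv3TubeProfileCorner
import Summits.QuantumFields.YangMills.Theorems.AlphaInputsT3ACv3SphereAxialGaugeTop
import HarnessLib

/-!
# `AlphaInputsT3ACv3StartSystem` — START v3.1 for the (FL) `hLift` binder, row (S5), part 4 (defs): **THE CANONICAL TUBE∕BALL SYSTEM OF A REGION `Ω`** read into the abstract
# assembly `…v3StartAssembly.startU` — tubes = the coarse plaquettes `Q ∈ plaqsIn k Ω` (all four cells in Ω), transverse form `t_Q := s + β_Q` with ★w2 g2's quadrant profile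
# `betaQB r negμ negν` and the QUADRANT RULE «toward a missing cell at the ∂Ω endpoint» (`quadOf`), logarithm `F′_Q := logSU (V(∂Q)⁻¹-word)`, balls = cubes of half-side `R` around the
# INTERIOR VERTICES (all `2^d` cells in Ω), radii `r := L^k∕16`, `Rt := 2r+2`, `R := 2r+3`; the ball model fields `Mball v` stay a PARAMETER (the d = 3 seam `…v3BallSystem.ballModel`
# is plugged at `P := F.P K`) — lane `pub-balaban3d` ∕ cell `ym3-torus`, seat `ym-ust-19936-w1` (g2, LEAD)

WHY (bus START v3.1 02:53Z (i)–(iii); PROGRESS 3∕4 03:24Z∕03:36Z).  `…v3StartAssembly.dist1_plaqHol_startU_le` bounds the start field's constrained plaquettes under lattice binders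
(A3)–(A5) + ball binders; (S5)-4b (★w2 g2 + w8) discharges the lattice binders FOR THIS SYSTEM, so its objects must be fixed names: THIS FILE fixes them, proof-free, for general
`Params`, level `k`, region `Ω : Set (Site P 0)` and gauge group `SU(n)`.  §1 torus helpers (`unshift`, `shiftBy`, `CellIn`, `cellOf`, `vertexSite`); §2 the quadrant rule `quadOf`
(`MissingAhead`∕`MissingBehind`: some cell continuing the quadrant's cell across the far∕near endpoint of the edge is NOT in Ω; else `(false,false)`); §3 radii `rT`, `RtT`, `RbT`; §4 the
system: `IsTubeΩ`, `tfOf`, `wordQ`∕`FpOf` (+ `expSU_FpOf`, `norm_FpOf_le`), `IsInteriorVertex`, `IsBallΩ`, `tubeSecΩ`, `ballUΩ`, ★`startSys`; §5 the readings `startSys_eq`,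
`curlB_tfOf`∕`abs_curlB_tfOf_le`∕`curlB_tfOf_longitudinal` (from ★w2's `curlB_stringInd_add_betaQB`), `tfOf_eq_stringInd_of` (β-window: where `t_Q = s`).
HONEST FRAMING.  Definitions and unfoldings only; no estimate; the lattice binders are NOT discharged here; (FL)∕`hLift` NOT proved; count-neutral helper toward R3 2′ (items 19936∕19935);
registry untouched; nothing about d = 4, the continuum, or a mass gap; YM₃ on T³ is rung R3, not Clay.

References: T. Bałaban, Commun. Math. Phys. 102 (1985) 277–309 [Balaban1985Variational] ((11)–(14) pp.279–280); Commun. Math. Phys. 98 (1985) 17–51 [Balaban1985Averaging]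
((8)–(9), (12) p.19).
-/

set_option autoImplicit false

noncomputable section

open scoped Matrix.Norms.L2Operator

namespace Summit.QuantumFields.YangMills.Theorems.TubeStart

open Literature.MathematicalPhysics.QuantumFieldTheory.Balaban1983to89
open Literature.MathematicalPhysics.QuantumFieldTheory.Balaban1983to89.T4AdjointCovarianceUnitary (lieSU expSU)
open Literature.MathematicalPhysics.QuantumFieldTheory.Balaban1983to89.BlockAveragingSectionAction (iterSec)
open Literature.MathematicalPhysics.QuantumFieldTheory.Balaban1983to89.B10Eq38TorusDomains (toFine plaqsIn)
open Summit.QuantumFields.Balaban3D.Carriers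
open Summit.QuantumFields.YangMills.Theorems.ModelBox
open Summit.QuantumFields.YangMills.Theorems.TubeProfile (betaQB curlB_stringInd_add_betaQB abs_curlB_stringInd_add_betaQB_le curlB_stringInd_add_betaQB_longitudinal betaQB_window)
open Summit.QuantumFields.YangMills.Theorems.SphereAxialGauge (logSU expSU_logSU norm_logSU_le)

/-! ## §1 Torus helpers -/

section Torus

variable {P : Params} {j : ℕ}

/-- One step BACK in direction `μ`: `x − e_μ`. [folklore] -/
def unshift (x : Site P j) (μ : Fin P.d) : Site P j := Function.update x μ (x μ - 1)

/-- `(x − e_μ) + e_μ = x`. [folklore] -/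
@[simp] theorem shift_unshift (x : Site P j) (μ : Fin P.d) : (unshift x μ).shift μ = x := by
  funext i
  simp only [Site.shift, unshift, Function.update_apply]
  split_ifs with h
  · subst h; ring
  · rfl

/-- `(x + e_μ) − e_μ = x`. [folklore] -/
@[simp] theorem unshift_shift (x : Site P j) (μ : Fin P.d) : unshift (x.shift μ) μ = x := by
  funext i
  simp only [Site.shift, unshift, Function.update_apply]
  split_ifs with h
  · subst h; ring
  · rfl

/-- Shifting by a 0∕1 vector: `x + Σ_{f i} e_i`. [folklore] -/
def shiftBy (x : Site P j) (f : Fin P.d → Bool) : Site P j := fun i => x i + if f i then 1 else 0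

/-- A level-`j` CELL (site of `T^{(j)}`) lies in the region iff its representative fine site does (for a region saturated at level `j` this is the whole block). [cite: Balaban1985UV3, (38)–(39) p.266] -/
def CellIn (Ω : Set (Site P 0)) (j : ℕ) (z : Site P j) : Prop := toFine j z ∈ Ω

/-- The four CELLS of a coarse plaquette `Q = (y; μ, ν)`, indexed by quadrant signs `(negμ, negν)`: `true` = the cell on the `≤ 0` side of the chart (not shifted), `false` = the `≥ 1` side
(shifted) — ★w2 g2's `betaQB` convention. [folklore] -/
def cellOf (Q : Plaq P j) (s : Bool × Bool) : Site P j :=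
  let z := if s.1 then Q.src else Q.src.shift Q.μ
  if s.2 then z else z.shift Q.ν

/-- **THE VERTEX SITE** of a coarse site `y`: the LAST fine site of the cell `y` in every direction (the corner the cell shares with the cells `y + Σ e_i`). [folklore] -/
def vertexSite (k : ℕ) (y : Site P k) : Site P 0 := fun i => (((y i).val * P.L ^ k + (P.L ^ k - 1) : ℕ) : ZMod (P.sitesPerDir 0))

end Torus

/-! ## §2 The quadrant rule -/

section Quadrant

variable {P : Params} {k : ℕ} (Ω : Set (Site P 0))

/-- Some cell continuing the quadrant cell `cellOf Q s` across the FAR endpoint of the edge (direction `i ∉ {μ, ν}`) is missing from Ω. [folklore] -/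
def MissingAhead (Q : Plaq P k) (s : Bool × Bool) : Prop := ∃ i, i ≠ Q.μ ∧ i ≠ Q.ν ∧ ¬ CellIn Ω k ((cellOf Q s).shift i)

/-- Some cell continuing the quadrant cell across the NEAR endpoint of the edge is missing from Ω. [folklore] -/
def MissingBehind (Q : Plaq P k) (s : Bool × Bool) : Prop := ∃ i, i ≠ Q.μ ∧ i ≠ Q.ν ∧ ¬ CellIn Ω k (unshift (cellOf Q s) i)

open Classical in
/-- **THE QUADRANT RULE** «toward a missing cell at the ∂Ω endpoint, so the tube ends for free» (START v3.1 (i)): a quadrant whose cell has a missing continuation ahead, else one with a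
missing continuation behind, else `(false, false)` (both endpoints interior: balls at both ends). [cite: Balaban1985Variational, (11) p.279] -/
def quadOf (Q : Plaq P k) : Bool × Bool :=
  if h : ∃ s, MissingAhead Ω Q s then Classical.choose h
  else if h' : ∃ s, MissingBehind Ω Q s then Classical.choose h'
  else (false, false)

/-- The rule's first clause. [folklore] -/
theorem missingAhead_quadOf {Q : Plaq P k} (h : ∃ s, MissingAhead Ω Q s) : MissingAhead Ω Q (quadOf Ω Q) := by
  classical
  unfold quadOf
  rw [dif_pos h]
  exact Classical.choose_spec h

/-- The rule's second clause. [folklore] -/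
theorem missingBehind_quadOf {Q : Plaq P k} (h : ¬ ∃ s, MissingAhead Ω Q s) (h' : ∃ s, MissingBehind Ω Q s) : MissingBehind Ω Q (quadOf Ω Q) := by
  classical
  unfold quadOf
  rw [dif_neg h, dif_pos h']
  exact Classical.choose_spec h'

/-- The rule's default. [folklore] -/
theorem quadOf_of_not {Q : Plaq P k} (h : ¬ ∃ s, MissingAhead Ω Q s) (h' : ¬ ∃ s, MissingBehind Ω Q s) : quadOf Ω Q = (false, false) := by
  classical
  unfold quadOf
  rw [dif_neg h, dif_neg h']

end Quadrant

/-! ## §3 Radii -/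

section Radii

variable (P : Params) (k : ℕ)

/-- Tube profile radius `r := ⌊L^k∕16⌋` (window `[−2r, 2r+1]`, `2r+1 ≍ L^k∕8`). [cite: Balaban1985Variational, (14) p.280] -/
def rT : ℕ := P.L ^ k / 16

/-- Tube box transverse half-width `Rt := 2r + 2` (one more than the window, so plaquettes touching an active bond are charted). [folklore] -/
def RtT : ℕ := 2 * rT P k + 2

/-- Ball cube half-side `R := 2r + 3`. [folklore] -/
def RbT : ℕ := 2 * rT P k + 3

/-- `Rt + 1 = R`. [folklore] -/
theorem RtT_succ : RtT P k + 1 = RbT P k := by unfold RtT RbT; omega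

end Radii

/-! ## §4 The system -/

section System

variable {P : Params} {n : Type*} [Fintype n] [DecidableEq n] [Nonempty n] (k : ℕ) (Ω : Set (Site P 0))

open Classical in
/-- **TUBES = THE COARSE PLAQUETTES OF THE REGION** (all four corners, i.e. all four cells of the edge, in Ω). [cite: Balaban1985Variational, (3) p.278] -/
def IsTubeΩ (Q : Plaq P k) : Prop := Q ∈ plaqsIn k Ω

/-- **THE TRANSVERSE FORM OF A TUBE**: string indicator plus the quadrant profile chosen by the rule. [cite: Balaban1985Variational, (11)+(14) pp.279–280] -/
def tfOf (Q : Plaq P k) : (Fin P.d → ℤ) → Fin P.d → ℝ := stringInd Q.μ Q.ν + betaQB (rT P k) (quadOf Ω Q).1 (quadOf Ω Q).2 Q.μ Q.ν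

variable (V : GaugeField P k (Matrix.specialUnitaryGroup n ℂ))

/-- The word `V⟨y,ν⟩·V⟨y+ν,μ⟩·V⟨y+μ,ν⟩⁻¹·V⟨y,μ⟩⁻¹ = (V(∂Q))⁻¹` whose logarithm the tube carries (the `hF` orientation of `…TubeGraft`). [cite: Balaban1985Averaging, (9) p.19] -/
def wordQ (Q : Plaq P k) : Matrix.specialUnitaryGroup n ℂ := V ⟨Q.src, Q.ν⟩ * V ⟨Q.src.shift Q.ν, Q.μ⟩ * (V ⟨Q.src.shift Q.μ, Q.ν⟩)⁻¹ * (V ⟨Q.src, Q.μ⟩)⁻¹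

/-- `wordQ = (V(∂Q))⁻¹`. [cite: Balaban1985Averaging, (9) p.19] -/
theorem wordQ_eq_inv (Q : Plaq P k) : wordQ k V Q = (GaugeField.plaqHol V Q)⁻¹ := by
  simp only [wordQ, GaugeField.plaqHol, mul_inv_rev, inv_inv, mul_assoc]

/-- **THE TUBE'S LOGARITHM** `F′_Q := logSU ((V(∂Q))⁻¹)` (★w5 g2's windowed `logSU`). [cite: Balaban1985Variational, (15) p.280] -/
def FpOf (Q : Plaq P k) : lieSU n := logSU (wordQ k V Q)

/-- In the log window the tube's flux is the word: `expSU F′_Q = V⟨y,ν⟩·V⟨y+ν,μ⟩·V⟨y+μ,ν⟩⁻¹·V⟨y,μ⟩⁻¹` (the `hF` binder of `…TubeGraft`). [cite: Balaban1985Variational, (15) p.280] -/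
theorem expSU_FpOf (Q : Plaq P k) (h : ‖((wordQ k V Q : Matrix.specialUnitaryGroup n ℂ) : Matrix n n ℂ) - 1‖ ≤ 1 / 4 ∧
    (Fintype.card n : ℝ) * ‖((wordQ k V Q : Matrix.specialUnitaryGroup n ℂ) : Matrix n n ℂ) - 1‖ < Real.pi) :
    expSU (FpOf k V Q) = V ⟨Q.src, Q.ν⟩ * V ⟨Q.src.shift Q.ν, Q.μ⟩ * (V ⟨Q.src.shift Q.μ, Q.ν⟩)⁻¹ * (V ⟨Q.src, Q.μ⟩)⁻¹ :=
  expSU_logSU _ h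

/-- `‖F′_Q‖ ≤ 2‖(V(∂Q))⁻¹ − 1‖`. [cite: Balaban1985Variational, (15) p.280] -/
theorem norm_FpOf_le (Q : Plaq P k) : ‖((FpOf k V Q : lieSU n) : Matrix n n ℂ)‖ ≤ 2 * ‖((wordQ k V Q : Matrix.specialUnitaryGroup n ℂ) : Matrix n n ℂ) - 1‖ :=
  norm_logSU_le _

/-- **INTERIOR VERTEX**: all `2^d` cells around the vertex of `y` lie in Ω. [folklore] -/
def IsInteriorVertex (y : Site P k) : Prop := ∀ f : Fin P.d → Bool, CellIn Ω k (shiftBy y f)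

/-- **BALL CENTRES = THE VERTEX SITES OF THE INTERIOR VERTICES.** [cite: Balaban1985Variational, (11) p.279] -/
def IsBallΩ (v : Site P 0) : Prop := ∃ y : Site P k, IsInteriorVertex k Ω y ∧ v = vertexSite k y

/-- Stage (T) of the canonical system. [cite: Balaban1985Variational, (11) p.279] -/
def tubeSecΩ : GaugeField P 0 (Matrix.specialUnitaryGroup n ℂ) := tubeSec V (RtT P k) (FpOf k V) (tfOf k Ω) (IsTubeΩ k Ω)

variable (Mball : Site P 0 → (Fin P.d → ℤ) → Fin P.d → Matrix.specialUnitaryGroup n ℂ)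

/-- The ball fields of the canonical system: the model fields `Mball v` grafted into stage (T) on the cubes of half-side `R`. [cite: Balaban1985Variational, (11) p.279] -/
def ballUΩ (v : Site P 0) : GaugeField P 0 (Matrix.specialUnitaryGroup n ℂ) := ballField v (RbT P k) (Mball v) (tubeSecΩ k Ω V)

/-- **★ THE START FIELD OF THE CANONICAL SYSTEM** (balls ▹ tubes ▹ section), ball model fields a parameter. [cite: Balaban1985Variational, (11) p.279] -/
def startSys : GaugeField P 0 (Matrix.specialUnitaryGroup n ℂ) :=
  startU V (RtT P k) (FpOf k V) (tfOf k Ω) (IsTubeΩ k Ω) (IsBallΩ k Ω) (fun v b => BallBond v (RbT P k) b) (ballUΩ k Ω V Mball)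

/-! ## §5 Readings -/

/-- `startSys` is `startU` of the system (definitional). [folklore] -/
theorem startSys_eq : startSys k Ω V Mball =
    ballGraft (IsBallΩ k Ω) (fun v b => BallBond v (RbT P k) b) (ballUΩ k Ω V Mball) (tubeSecΩ k Ω V) := rfl

/-- The transverse curl of a tube's form: `−ρ_Q`. [folklore] -/
theorem curlB_tfOf (Q : Plaq P k) (u : Fin P.d → ℤ) :
    curlB (tfOf k Ω Q) u Q.μ Q.ν = -TubeProfile.rhoQ (rT P k) (quadOf Ω Q).1 (quadOf Ω Q).2 (u Q.μ) (u Q.ν) :=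
  curlB_stringInd_add_betaQB _ _ _ _ _ (ne_of_lt Q.hμν) u

/-- `|curl t_Q| ≤ (2r+1)⁻²` on transverse plaquettes. [cite: Balaban1985Variational, (14) p.280] -/
theorem abs_curlB_tfOf_le (Q : Plaq P k) (u : Fin P.d → ℤ) : |curlB (tfOf k Ω Q) u Q.μ Q.ν| ≤ ((2 * (rT P k : ℝ) + 1))⁻¹ ^ 2 :=
  abs_curlB_stringInd_add_betaQB_le _ _ _ _ _ (ne_of_lt Q.hμν) u

/-- Longitudinal plaquettes of a tube's form have zero curl. [cite: Balaban1985Averaging, (12) p.19] -/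
theorem curlB_tfOf_longitudinal (Q : Plaq P k) {κ : Fin P.d} (hκμ : κ ≠ Q.μ) (hκν : κ ≠ Q.ν) (u : Fin P.d → ℤ) (α : Fin P.d) :
    curlB (tfOf k Ω Q) u α κ = 0 ∧ curlB (tfOf k Ω Q) u κ α = 0 :=
  curlB_stringInd_add_betaQB_longitudinal _ _ _ _ _ hκμ hκν u α

/-- **THE TUBE BUDGET**: every model plaquette of a tube's form has `|curlB t_Q| ≤ (2r+1)⁻²`. [cite: Balaban1985Variational, (14) p.280] -/
theorem abs_curlB_tfOf_le_all (Q : Plaq P k) (u : Fin P.d → ℤ) (α β : Fin P.d) : |curlB (tfOf k Ω Q) u α β| ≤ ((2 * (rT P k : ℝ) + 1))⁻¹ ^ 2 := by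
  have hpos : (0 : ℝ) ≤ ((2 * (rT P k : ℝ) + 1))⁻¹ ^ 2 := by positivity
  by_cases hα : α = Q.μ
  · by_cases hβ : β = Q.ν
    · subst hα; subst hβ; exact abs_curlB_tfOf_le k Ω Q u
    · by_cases hβ' : β = Q.μ
      · subst hα; subst hβ'; rw [show curlB (tfOf k Ω Q) u Q.μ Q.μ = 0 by simp [curlB]]; simpa using hpos
      · rw [(curlB_tfOf_longitudinal k Ω Q hβ' hβ u α).1]; simpa using hpos
  · by_cases hα' : α = Q.ν
    · by_cases hβ : β = Q.μ
      · subst hα'; subst hβ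
        rw [curlB_swap, abs_neg]; exact abs_curlB_tfOf_le k Ω Q u
      · by_cases hβ' : β = Q.ν
        · subst hα'; subst hβ'; rw [show curlB (tfOf k Ω Q) u Q.ν Q.ν = 0 by simp [curlB]]; simpa using hpos
        · rw [(curlB_tfOf_longitudinal k Ω Q hβ hβ' u α).1]; simpa using hpos
    · rw [(curlB_tfOf_longitudinal k Ω Q hα hα' u β).2]; simpa using hpos

/-- **OFF THE β-WINDOW THE FORM IS THE STRING INDICATOR**: if `|u_μ| > 2r` or `|u_ν| > 2r` then `t_Q(u, κ) = s(u, κ)`. [folklore] -/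
theorem tfOf_eq_stringInd_of (Q : Plaq P k) {u : Fin P.d → ℤ} (κ : Fin P.d) (h : 2 * (rT P k : ℤ) < |u Q.μ| ∨ 2 * (rT P k : ℤ) < |u Q.ν|) :
    tfOf k Ω Q u κ = stringInd Q.μ Q.ν u κ := by
  unfold tfOf
  simp only [Pi.add_apply, add_eq_left]
  by_contra hne
  obtain ⟨h1, h2⟩ := betaQB_window (rT P k) (quadOf Ω Q).1 (quadOf Ω Q).2 Q.μ Q.ν hne
  rcases h with h | h <;> omega

end System

end Summit.QuantumFields.YangMills.Theorems.TubeStart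

end
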